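import Summits.KontsevichZagierPeriods.KontsevichZagierPeriods.Theorems.HurwitzMicroSectorsNormalFormPrincipleDlogMoves

/-!
# `NormalFormPrinciple` (stmt-KontsevichZagierPeriods-3869), line `SketchIdeator1` —
# stub `exists_eq_carrier_sub` (siege k10: the explicit / elementary route)

A dlog representation `L = [(a,b), c/y]` (`a, b, c ∈ ℚ`, `0 < a < b`) equals, in
`FormalRep ⧸ relations`, the difference of two **integer carriers**
`Λ(B,c) − Λ(A,c)`, `Λ(N,c) := [(1,N), c/y]`, where `b/a = B/A` is the reduced fraction
(`A = (b/a).den`, `B = (b/a).num`).  The certificate is explicit and uses exactly two moves of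
the Kontsevich–Zagier calculus, both already in the tree
(`Theorems/HurwitzMicroSectorsNormalFormPrincipleDlogMoves.lean`):

* **scaling** (rule 2, the dilation `y ↦ (A/a)·y`): `[(a,b), c/y] ≡ [(A,B), c/y]`
  (`Dlog.dlog_scale_mem_relations`);
* **splitting** (rule 1a plus the null point `{A}`): `[(1,B), c/y] ≡ [(1,A), c/y] + [(A,B), c/y]`
  (`Dlog.split_mem_relations`).

Hence `[L] − ([(1,B), c/y] − [(1,A), c/y]) = ([L] − [(A,B), c/y]) − ([(1,B), c/y] − [(1,A), c/y] −
[(A,B), c/y]) ∈ relations`.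

Sources: M. Kontsevich, D. Zagier, *Periods* (2001), §1.1 (`log 2 = ∫₁² dx/x`), §1.2 rules (1), (2).
No definitions are introduced.
-/

noncomputable section

open Set MeasureTheory
open Literature.NumberTheory.Transcendental Literature.NumberTheory.Transcendental.KZ

namespace Summit.KontsevichZagierPeriods.HurwitzMicroSectors.NormalFormPrinciple.CarrierSubK10

open Summit.KontsevichZagierPeriods.HurwitzMicroSectors.NormalFormPrinciple.PiBox.Dlog
  (dlog_scale_mem_relations split_mem_relations)

/-- **Reduced fraction of a ratio of positive rationals.** For rationals `0 < a < b` there are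
naturals `1 ≤ A < B` with `b/a = B/A` (namely `A = (b/a).den`, `B = (b/a).num`), and the dilation
factor `s = A/a` satisfies `s·a = A`, `s·b = B`. [folklore] -/
theorem exists_reduced_ratio {a b : ℚ} (ha : 0 < a) (hab : a < b) :
    ∃ A B : ℕ, 1 ≤ A ∧ A < B ∧ (b:ℝ) / a = B / A ∧
      (A:ℚ) / a * a = A ∧ (A:ℚ) / a * b = B := by
  set q : ℚ := b / a with hq
  have hq1 : 1 < q := (one_lt_div ha).mpr hab
  have hnum : 0 < q.num := Rat.num_pos.mpr (one_pos.trans hq1)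
  have hB : ((q.num.toNat : ℕ) : ℤ) = q.num := Int.toNat_of_nonneg hnum.le
  have hBq : ((q.num.toNat : ℕ) : ℚ) = q.num := by exact_mod_cast hB
  have hdq : (q.den : ℚ) < q.num := by
    have h := hq1
    rw [← Rat.num_div_den q, one_lt_div (by exact_mod_cast q.den_pos)] at h
    exact h
  refine ⟨q.den, q.num.toNat, q.den_pos, ?_, ?_, ?_, ?_⟩
  · rw [Int.lt_toNat]
    exact_mod_cast hdq
  · have h : (b / a : ℚ) = (q.num.toNat : ℚ) / q.den := by
      rw [hBq, Rat.num_div_den]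
    have h' := congrArg (fun r : ℚ => (r : ℝ)) h
    push_cast at h'
    exact h'
  · field_simp
  · rw [div_mul_eq_mul_div, mul_div_assoc, ← hq, hBq, Rat.den_mul_eq_num]

/-- **Integer carriers of a dlog representation** (stub `exists_eq_carrier_sub` of the line
`SketchIdeator1`, dlog layer of `stub_boxRigidity`). Let `R a b c = [(a,b), c/y]` be any choice
of dlog representations (`0 < a`). For rationals `0 < a < b` and any representation `L` on the
slab `{a < y < b}` with integrand `c/y` there, writing `b/a = B/A` in lowest terms
(`1 ≤ A < B`), one has `[L] = [R 1 B c] − [R 1 A c]` in `FormalRep ⧸ relations`: scale `L` by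
`y ↦ (A/a)·y` onto `(A,B)` (rule 2, Jacobian `A/a`, `c/y` is dilation-invariant as a 1-form) and
split `(1,B) = (1,A) ∪ {A} ∪ (A,B)` (rule 1a and a null point).
[cite: KontsevichZagier2001, §1.1, §1.2 rules (1), (2)] -/
theorem exists_eq_carrier_sub {R : ℚ → ℚ → ℚ → IntegralRep 1}
    (hR : ∀ a b c, 0 < a → (R a b c).domain = {x | x 0 ∈ Set.Ioo (a:ℝ) b} ∧
      (R a b c).integrand = fun x => (c:ℝ) / x 0)
    {a b c : ℚ} (ha : 0 < a) (hab : a < b) (L : IntegralRep 1)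
    (hd : L.domain = {x | x 0 ∈ Set.Ioo (a:ℝ) b})
    (hi : EqOn L.integrand (fun x => (c:ℝ) / x 0) L.domain) :
    ∃ A B : ℕ, 1 ≤ A ∧ A < B ∧ (b:ℝ) / a = B / A ∧
      QuotientAddGroup.mk' relations (of L) =
        QuotientAddGroup.mk' relations (of (R 1 B c)) -
          QuotientAddGroup.mk' relations (of (R 1 A c)) := by
  obtain ⟨A, B, hA, hAB, hratio, hsa, hsb⟩ := exists_reduced_ratio ha hab
  refine ⟨A, B, hA, hAB, hratio, ?_⟩
  have hApos : (0:ℚ) < A := by exact_mod_cast hA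
  obtain ⟨hdAB, hiAB⟩ := hR A B c hApos
  obtain ⟨hd1B, hi1B⟩ := hR 1 B c one_pos
  obtain ⟨hd1A, hi1A⟩ := hR 1 A c one_pos
  -- rule 2: `[L] − [(A,B), c/y] ∈ relations` by the dilation `y ↦ (A/a)·y`
  have h1 : of L - of (R A B c) ∈ relations := by
    refine dlog_scale_mem_relations (s := (A:ℚ) / a) L (R A B c) hd ?_ hi ?_ ha (div_pos hApos ha)
    · rw [hdAB, hsa, hsb]
    · rw [hiAB]
      exact fun _ _ => rfl
  -- rule 1a: `[(1,B), c/y] − [(1,A), c/y] − [(A,B), c/y] ∈ relations`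
  have h2 : of (R 1 B c) - of (R 1 A c) - of (R A B c) ∈ relations := by
    refine split_mem_relations (R 1 B c) (R 1 A c) (R A B c) hd1B hd1A hdAB ?_ ?_ ?_ ?_
    · exact_mod_cast hA
    · exact_mod_cast hAB.le
    · rw [hi1A, hi1B]
      exact fun _ _ => rfl
    · rw [hiAB, hi1B]
      exact fun _ _ => rfl
  rw [← map_sub, QuotientAddGroup.mk'_apply, QuotientAddGroup.mk'_apply,
    QuotientAddGroup.eq_iff_sub_mem]
  have : of L - (of (R 1 B c) - of (R 1 A c)) =
      (of L - of (R A B c)) - (of (R 1 B c) - of (R 1 A c) - of (R A B c)) := by abel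
  rw [this]
  exact sub_mem h1 h2

end Summit.KontsevichZagierPeriods.HurwitzMicroSectors.NormalFormPrinciple.CarrierSubK10
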